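import Mathlib
import Summits.KontsevichZagierPeriods.Zeta5Search.BrickTwoDigitAll
import Summits.KontsevichZagierPeriods.Zeta5Search.BrickDigitStepDZero

/-!
# BrickHoleCells — THEOREM 7 LEMMA 1 (compensated valuation, EVERY level) with the digit-0 carry, THEOREM 8's
fact (K) «hole cells are `O(p^A)`», and the OFF-DIGIT THEOREM at EVERY level (cell zeta5-irr)

HONEST FRAMING: systematic search; no irrationality claim unless certified. INSTRUMENT lemmas of the ζ(5)
census cell zeta5-irr (HOME `run/shared/lean/pub/zeta5-irr/`; memos `zi-p2/probes/B8/thm7/THEOREM7.md` §1 LEMMA 1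
«(i) ṽ_K(N) ≥ A·v(C(N,K)) … (ii) v(r_K^{(s)}(N)) ≥ ṽ_K(N) for every s ∈ {0} ∪ [1,A]», COROLLARY 1 (= OFF-DIGIT THEOREM:
«for the row np and p ∤ K … v(C(np,K)) ≥ 1 and LEMMA 1 gives v(r_K^{(s)}(np)) ≥ A … hence v(p^{(L+1)τ_s}cell_K^{(s)}(np))
≥ A−1−L»), and `thm8/THEOREM8.md` §2 fact (K) «HOLE CELLS: if k₀ > M₀ (bottom digits) then v(C(M,k)) ≥ 1 [Kummer] …
hence v(r_k^{(s)}(M)) ≥ A»). Nothing here is about ζ(5); no irrationality content; filing moves no rung. Filed by the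
engine seat zi-eng (g8): assembly of `BrickCellValuation.cell_valuation` ((C2⁺) at every level), Kummer
(`BrickTopKummer`), Lucas at digit 0 (Mathlib `Choose.choose_modEq_choose_mod_mul_choose_div_nat`),
`BrickLaurentValuation.laurent_centre` and `BrickDigitStepDZero.hsum_valuation` (the harmonic cell).

## The statements

`p` odd prime, `2B ≤ A`, level `L` (`K ≤ n < p^{L+1}`), `r_K^{(s)}(n) = p^{L(A−s)}·cell A B 1 n K s` (`1 ≤ s ≤ A`),
`r_K^{(0)}(n) = p^{LA}·cellZero A B 1 n K`, `v = v_p(C(n,K))`: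

* `padicValuation_cTop_le_choose` (LEMMA 1 (i)): `v(cTop A B ε n K) ≤ exp(−(A·v + B·σ^{(L)}_K(n)))`;
* `pow_mul_cell_valuation` / `pow_mul_cell_one_valuation` / `pow_mul_cellZero_valuation` (LEMMA 1 (ii), exponent
  bookkeeping form): `v(p^e·cell A B 1 n K s) ≤ exp(L(A−s) − e − A·v)`, `v(p^e·cellZero A B 1 n K) ≤ exp(LA − e − A·v)`;
* `one_le_padicValNat_choose_of_mod_lt` (digit-0 carry): `n % p < K % p ⇒ 1 ≤ v_p(C(n,K))`;
* **`holeCell_le`, `holeCellZero_le` (fact (K))**: for a hole cell (`n % p < K % p`) `v(r_K^{(s)}(n)) ≥ A`, every `s`;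
* **`offDigit_term_le_level`, `offDigitZero_term_le_level`, `offDigit_sum_le_level`, `offDigitZero_sum_le_level`
  (OFF-DIGIT THEOREM at every level)**: for `n < p^{L+1}`, `p ∤ K ≤ np`:
  `v(p^{(L+1)(A−1−s)}·cell A B 1 (np) K s) ≤ exp(L + 1 − A)` (`s + 1 ≤ A`) and
  `v(p^{(L+1)(A−1)}·cellZero A B 1 (np) K) ≤ exp(L + 1 − A)`; summed over `{K ≤ np : p ∤ K}` likewise — so the
  off-digit half of `β_s(np) − β_s(n)` is `≡ 0 (mod p³)` whenever `L + 4 ≤ A` (`offDigit_sum_le_three`,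
  `offDigitZero_sum_le_three`).
-/

namespace Summit.KontsevichZagierPeriods.Zeta5Search.BrickHoleCells

open Finset Nat WithZero
open Summit.KontsevichZagierPeriods.Zeta5Search.BrickTopCoefficient (cTop)
open Summit.KontsevichZagierPeriods.Zeta5Search.BrickLaurent (cell laurent)
open Summit.KontsevichZagierPeriods.Zeta5Search.BrickLaurentValuation (laurent_centre padicValuation_natCast)
open Summit.KontsevichZagierPeriods.Zeta5Search.BrickPartialFractions (cellZero)
open Summit.KontsevichZagierPeriods.Zeta5Search.BrickCellValuation (sigmaTop cell_valuation)
open Summit.KontsevichZagierPeriods.Zeta5Search.BrickTopKummer (padicValuation_choose_add_le)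
open Summit.KontsevichZagierPeriods.Zeta5Search.BrickTwoDigitAll (padicValuation_centre_le_one)
open Summit.KontsevichZagierPeriods.Zeta5Search.BrickHarmonicBlocks (hsum)
open Summit.KontsevichZagierPeriods.Zeta5Search.BrickDigitStepDZero (cellZero_eq hsum_valuation)

noncomputable section

variable {p : ℕ} [Fact p.Prime]

/-! ## LEMMA 1 (i): the top coefficient carries `C(n,K)^A` and the compensating carries -/

/-- **LEMMA 1 (i)**: for an odd prime `p`, `K ≤ n < p^{L+1}`:
`v(cTop A B ε n K) ≤ exp(−(A·v_p(C(n,K)) + B·σ^{(L)}_K(n)))`. -/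
theorem padicValuation_cTop_le_choose (hp2 : p ≠ 2) (A B ε : ℕ) {L n K : ℕ} (hn : n < p ^ (L + 1)) (hK : K ≤ n) :
    Rat.padicValuation p (cTop A B ε n K) ≤
      exp (-((A * padicValNat p (n.choose K) + B * sigmaTop p L n K : ℕ) : ℤ)) := by
  -- the four factors
  have h1 : Rat.padicValuation p ((-1 : ℚ) ^ (n * B + K * A)) = 1 := by
    rw [map_pow, Valuation.map_neg, map_one, one_pow]
  have h2 : Rat.padicValuation p (((n : ℚ) / 2 - K) ^ ε) ≤ 1 := by
    rw [map_pow]; exact pow_le_one' (padicValuation_centre_le_one hp2 n K) _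
  have h3 : Rat.padicValuation p ((n.choose K : ℚ) ^ A) ≤ exp (-((A * padicValNat p (n.choose K) : ℕ) : ℤ)) := by
    rw [map_pow, padicValuation_natCast (Nat.choose_pos hK).ne', ← exp_nsmul, nsmul_eq_mul, exp_le_exp]
    push_cast
    linarith
  have h4 : Rat.padicValuation p ((((n + K).choose K : ℚ) * ((2 * n - K).choose n : ℚ)) ^ B) ≤
      exp (-((B * sigmaTop p L n K : ℕ) : ℤ)) := by
    have key : exp (-((B * sigmaTop p L n K : ℕ) : ℤ)) =
        (exp (-((if p ^ (L + 1) ≤ n + K then 1 else 0 : ℕ) : ℤ)) *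
          exp (-((if p ^ (L + 1) ≤ 2 * n - K then 1 else 0 : ℕ) : ℤ))) ^ B := by
      rw [← exp_add, ← exp_nsmul, nsmul_eq_mul, sigmaTop]; congr 1; push_cast; ring
    rw [map_pow, map_mul, key]
    refine pow_le_pow_left' (mul_le_mul' (padicValuation_choose_add_le hn (by omega)) ?_) B
    have h := padicValuation_choose_add_le (p := p) (L := L) (n := n - K) (k := n) (by omega) hn
    rwa [show n - K + n = 2 * n - K by omega] at h
  unfold cTop
  rw [map_mul, map_mul, map_mul, h1, one_mul]
  calc _ ≤ 1 * exp (-((A * padicValNat p (n.choose K) : ℕ) : ℤ)) * exp (-((B * sigmaTop p L n K : ℕ) : ℤ)) :=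
        mul_le_mul' (mul_le_mul' h2 h3) h4
    _ = _ := by rw [one_mul, ← exp_add]; congr 1; push_cast; ring

/-! ## LEMMA 1 (ii): `v(r_K^{(s)}(n)) ≥ ṽ_K(n) ≥ A·v_p(C(n,K))`, in exponent-bookkeeping form -/

/-- **LEMMA 1 (ii)** (`2K ≠ n` or `ε = 0`): `v(p^e·cell A B ε n K s) ≤ exp(L(A−s) − e − A·v_p(C(n,K)))`. -/
theorem pow_mul_cell_valuation (hp2 : p ≠ 2) {A B : ℕ} (hAB : 2 * B ≤ A) {L ε n K : ℕ} (hn : n < p ^ (L + 1))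
    (hK : K ≤ n) (hc : 2 * K ≠ n ∨ ε = 0) (e s : ℕ) :
    Rat.padicValuation p ((p : ℚ) ^ e * cell A B ε n K s) ≤
      exp ((L : ℤ) * (A - s : ℕ) - e - ((A * padicValNat p (n.choose K) : ℕ) : ℤ)) := by
  have hcell := cell_valuation (p := p) hAB hn hK hc s
  have htop := padicValuation_cTop_le_choose hp2 A B ε hn hK
  rw [map_mul, map_pow, Rat.padicValuation_self, ← exp_nsmul]
  refine (mul_le_mul' le_rfl (hcell.trans (mul_le_mul' htop le_rfl))).trans ?_
  rw [← exp_add, ← exp_add, exp_le_exp, nsmul_eq_mul]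
  push_cast
  linarith

/-- **LEMMA 1 (ii) for the full kernel (`ε = 1`), centre included**:
`v(p^e·cell A B 1 n K s) ≤ exp(L(A−s) − e − A·v_p(C(n,K)))` (at the centre `2K = n` the cell is the `ε = 0` cell
one depth lower, which is better by `L`). -/
theorem pow_mul_cell_one_valuation (hp2 : p ≠ 2) {A B : ℕ} (hAB : 2 * B ≤ A) {L n K : ℕ} (hn : n < p ^ (L + 1))
    (hK : K ≤ n) (e s : ℕ) :
    Rat.padicValuation p ((p : ℚ) ^ e * cell A B 1 n K s) ≤
      exp ((L : ℤ) * (A - s : ℕ) - e - ((A * padicValNat p (n.choose K) : ℕ) : ℤ)) := by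
  by_cases hc : 2 * K = n
  · by_cases hsA : A ≤ s
    · rw [cell, show A - s = 0 by omega, (laurent_centre A B hc 0).2, mul_zero, map_zero]
      exact _root_.zero_le
    · obtain ⟨d, hd⟩ : ∃ d, A - s = d + 1 := ⟨A - s - 1, by omega⟩
      have hcs : cell A B 1 n K s = cell A B 0 n K (s + 1) := by
        rw [cell, cell, hd, (laurent_centre A B hc d).1, show A - (s + 1) = d by omega]
      rw [hcs]
      refine (pow_mul_cell_valuation hp2 hAB (ε := 0) hn hK (Or.inr rfl) e (s + 1)).trans ?_
      rw [exp_le_exp, Nat.cast_sub (by omega : s + 1 ≤ A), Nat.cast_sub (by omega : s ≤ A)]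
      push_cast
      nlinarith [Int.natCast_nonneg L]
  · exact pow_mul_cell_valuation hp2 hAB hn hK (Or.inl hc) e s

/-- **LEMMA 1 (ii) for the harmonic cell `s = 0`**: `v(p^e·cellZero A B 1 n K) ≤ exp(LA − e − A·v_p(C(n,K)))`
(`v(H_K^{(s)}) ≥ −Ls` for `K < p^{L+1}`). -/
theorem pow_mul_cellZero_valuation (hp2 : p ≠ 2) {A B : ℕ} (hAB : 2 * B ≤ A) {L n K : ℕ} (hn : n < p ^ (L + 1))
    (hK : K ≤ n) (e : ℕ) :
    Rat.padicValuation p ((p : ℚ) ^ e * cellZero A B 1 n K) ≤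
      exp ((L : ℤ) * A - e - ((A * padicValNat p (n.choose K) : ℕ) : ℤ)) := by
  have hKlt : K < p ^ (L + 1) := lt_of_le_of_lt hK hn
  rw [cellZero_eq, mul_neg, Valuation.map_neg, Finset.mul_sum]
  refine Valuation.map_sum_le _ fun s hs => ?_
  have hs' := mem_Icc.1 hs
  rw [← mul_assoc, map_mul]
  refine (mul_le_mul' (pow_mul_cell_one_valuation hp2 hAB hn hK e s) (hsum_valuation hKlt s)).trans ?_
  rw [← exp_add, exp_le_exp, Nat.cast_sub hs'.2]
  linarith

/-! ## The digit-0 carry and THEOREM 8's fact (K): hole cells are `O(p^A)` -/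

/-- **Lucas at digit 0**: if the bottom digit of `K` exceeds that of `n` (`K ≤ n`) then `p ∣ C(n,K)`. -/
theorem one_le_padicValNat_choose_of_mod_lt {n K : ℕ} (hK : K ≤ n) (h : n % p < K % p) :
    1 ≤ padicValNat p (n.choose K) := by
  have hl := Choose.choose_modEq_choose_mod_mul_choose_div_nat (n := n) (k := K) (p := p)
  rw [Nat.choose_eq_zero_of_lt h, zero_mul] at hl
  exact one_le_padicValNat_of_dvd (Nat.choose_pos hK).ne' (Nat.modEq_zero_iff_dvd.1 hl)

/-- **Fact (K), cells `s ≥ 1`**: a hole cell (`n % p < K % p`, `K ≤ n < p^{L+1}`) has `v(p^{L(A−s)}·c_{K,s}(n)) ≥ A`. -/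
theorem holeCell_le (hp2 : p ≠ 2) {A B : ℕ} (hAB : 2 * B ≤ A) {L n K : ℕ} (hn : n < p ^ (L + 1)) (hK : K ≤ n)
    (h : n % p < K % p) (s : ℕ) :
    Rat.padicValuation p ((p : ℚ) ^ (L * (A - s)) * cell A B 1 n K s) ≤ exp (-(A : ℤ)) := by
  have hv : (1 : ℤ) ≤ padicValNat p (n.choose K) := by exact_mod_cast one_le_padicValNat_choose_of_mod_lt hK h
  refine (pow_mul_cell_one_valuation hp2 hAB hn hK (L * (A - s)) s).trans (exp_le_exp.2 ?_)
  simp only [Nat.cast_mul]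
  nlinarith [mul_nonneg (Int.natCast_nonneg A) (sub_nonneg.2 hv)]

/-- **Fact (K), harmonic cell**: a hole cell has `v(p^{LA}·cell^{(0)}_K(n)) ≥ A`. -/
theorem holeCellZero_le (hp2 : p ≠ 2) {A B : ℕ} (hAB : 2 * B ≤ A) {L n K : ℕ} (hn : n < p ^ (L + 1)) (hK : K ≤ n)
    (h : n % p < K % p) :
    Rat.padicValuation p ((p : ℚ) ^ (L * A) * cellZero A B 1 n K) ≤ exp (-(A : ℤ)) := by
  have hv : (1 : ℤ) ≤ padicValNat p (n.choose K) := by exact_mod_cast one_le_padicValNat_choose_of_mod_lt hK h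
  refine (pow_mul_cellZero_valuation hp2 hAB hn hK (L * A)).trans (exp_le_exp.2 ?_)
  simp only [Nat.cast_mul]
  nlinarith [mul_nonneg (Int.natCast_nonneg A) (sub_nonneg.2 hv)]

/-! ## The OFF-DIGIT THEOREM at every level -/

omit [Fact p.Prime] in
/-- The off-digit cells of the row `np` are hole cells: `(np) % p = 0 < K % p`. -/
theorem offDigit_isHole (n : ℕ) {K : ℕ} (hndvd : ¬ p ∣ K) : n * p % p < K % p := by
  rw [Nat.mul_mod_left]
  exact Nat.pos_of_ne_zero fun h0 => hndvd (Nat.dvd_of_mod_eq_zero h0)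

section offDigit

variable (hp2 : p ≠ 2) {A B : ℕ} (hAB : 2 * B ≤ A) {L n : ℕ} (hn : n < p ^ (L + 1))
include hp2 hAB hn

/-- **OFF-DIGIT THEOREM, termwise, cells `s ≥ 1`, level `L + 1`**: for `n < p^{L+1}` and `p ∤ K ≤ np`,
`v(p^{(L+1)(A−1−s)}·c_{K,s}(np)) ≥ A − 1 − L`. -/
theorem offDigit_term_le_level {K s : ℕ} (hK : K ≤ n * p) (hndvd : ¬ p ∣ K) (hs : s + 1 ≤ A) :
    Rat.padicValuation p ((p : ℚ) ^ ((L + 1) * (A - 1 - s)) * cell A B 1 (n * p) K s) ≤ exp ((L : ℤ) + 1 - A) := by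
  have hp : p.Prime := Fact.out
  have hnp : n * p < p ^ (L + 1 + 1) := by rw [pow_succ]; exact Nat.mul_lt_mul_of_pos_right hn hp.pos
  have hv : (1 : ℤ) ≤ padicValNat p ((n * p).choose K) := by
    exact_mod_cast one_le_padicValNat_choose_of_mod_lt hK (offDigit_isHole n hndvd)
  refine (pow_mul_cell_one_valuation hp2 hAB hnp hK ((L + 1) * (A - 1 - s)) s).trans (exp_le_exp.2 ?_)
  have e1 : ((A - 1 - s : ℕ) : ℤ) = A - 1 - s := by omega
  have e2 : ((A - s : ℕ) : ℤ) = A - s := by omega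
  simp only [Nat.cast_mul, Nat.cast_add, Nat.cast_one, e1, e2]
  nlinarith [mul_nonneg (Int.natCast_nonneg A) (sub_nonneg.2 hv), Int.natCast_nonneg L]

/-- **OFF-DIGIT THEOREM, termwise, harmonic cell, level `L + 1`**: `v(p^{(L+1)(A−1)}·cell^{(0)}_K(np)) ≥ A − 1 − L`. -/
theorem offDigitZero_term_le_level (hA : 1 ≤ A) {K : ℕ} (hK : K ≤ n * p) (hndvd : ¬ p ∣ K) :
    Rat.padicValuation p ((p : ℚ) ^ ((L + 1) * (A - 1)) * cellZero A B 1 (n * p) K) ≤ exp ((L : ℤ) + 1 - A) := by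
  have hp : p.Prime := Fact.out
  have hnp : n * p < p ^ (L + 1 + 1) := by rw [pow_succ]; exact Nat.mul_lt_mul_of_pos_right hn hp.pos
  have hv : (1 : ℤ) ≤ padicValNat p ((n * p).choose K) := by
    exact_mod_cast one_le_padicValNat_choose_of_mod_lt hK (offDigit_isHole n hndvd)
  refine (pow_mul_cellZero_valuation hp2 hAB hnp hK ((L + 1) * (A - 1))).trans (exp_le_exp.2 ?_)
  have e1 : ((A - 1 : ℕ) : ℤ) = A - 1 := by omega
  simp only [Nat.cast_mul, Nat.cast_add, Nat.cast_one, e1]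
  nlinarith [mul_nonneg (Int.natCast_nonneg A) (sub_nonneg.2 hv), Int.natCast_nonneg L]

/-- **OFF-DIGIT THEOREM, cells `s ≥ 1`**: `v(Σ_{K ≤ np, p ∤ K} p^{(L+1)τ_s}·c_{K,s}(np)) ≥ A − 1 − L`. -/
theorem offDigit_sum_le_level {s : ℕ} (hs : s + 1 ≤ A) :
    Rat.padicValuation p (∑ K ∈ (range (n * p + 1)).filter (fun K => ¬ p ∣ K),
      (p : ℚ) ^ ((L + 1) * (A - 1 - s)) * cell A B 1 (n * p) K s) ≤ exp ((L : ℤ) + 1 - A) :=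
  Valuation.map_sum_le _ fun K hK =>
    offDigit_term_le_level hp2 hAB hn (by have := mem_range.1 (mem_filter.1 hK).1; omega) (mem_filter.1 hK).2 hs

/-- **OFF-DIGIT THEOREM, harmonic cell**: `v(Σ_{K ≤ np, p ∤ K} p^{(L+1)τ_0}·cell^{(0)}_K(np)) ≥ A − 1 − L`. -/
theorem offDigitZero_sum_le_level (hA : 1 ≤ A) :
    Rat.padicValuation p (∑ K ∈ (range (n * p + 1)).filter (fun K => ¬ p ∣ K),
      (p : ℚ) ^ ((L + 1) * (A - 1)) * cellZero A B 1 (n * p) K) ≤ exp ((L : ℤ) + 1 - A) :=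
  Valuation.map_sum_le _ fun K hK =>
    offDigitZero_term_le_level hp2 hAB hn hA (by have := mem_range.1 (mem_filter.1 hK).1; omega) (mem_filter.1 hK).2

/-- The off-digit half of `β_s(np) − β_s(n)` is `≡ 0 (mod p³)` at every level `L ≤ A − 4` (cells `s ≥ 1`). -/
theorem offDigit_sum_le_three (hLA : L + 4 ≤ A) {s : ℕ} (hs : s + 1 ≤ A) :
    Rat.padicValuation p (∑ K ∈ (range (n * p + 1)).filter (fun K => ¬ p ∣ K),
      (p : ℚ) ^ ((L + 1) * (A - 1 - s)) * cell A B 1 (n * p) K s) ≤ exp (-3) :=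
  (offDigit_sum_le_level hp2 hAB hn hs).trans (exp_le_exp.2 (by omega))

/-- The off-digit half of `β_0(np) − β_0(n)` is `≡ 0 (mod p³)` at every level `L ≤ A − 4` (harmonic cell). -/
theorem offDigitZero_sum_le_three (hLA : L + 4 ≤ A) :
    Rat.padicValuation p (∑ K ∈ (range (n * p + 1)).filter (fun K => ¬ p ∣ K),
      (p : ℚ) ^ ((L + 1) * (A - 1)) * cellZero A B 1 (n * p) K) ≤ exp (-3) :=
  (offDigitZero_sum_le_level hp2 hAB hn (by omega)).trans (exp_le_exp.2 (by omega))

end offDigit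

end

end Summit.KontsevichZagierPeriods.Zeta5Search.BrickHoleCells
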